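import Summits.AtomisticToContinuum.FouriersLaw.Theorems.HiddenChargeMazurOddChargeExistsStubOverlapDensityLimitMoments
import Summits.AtomisticToContinuum.FouriersLaw.Theorems.OddSectorIrreversibilitySubBallisticWindowStaticCurrentBound

/-!
# Stub `stub_overlapDensityLimit` of crux `OddChargeExists` — part 2/4: window observables and bond currents

`--supports stmt-AtomisticToContinuum-13511` (crux `HiddenChargeMazur.OddChargeExists`, line `registered`, stub
`stub_overlapDensityLimit`). Bookkeeping for polynomial window densities `g` on `k` consecutive sites read on the
`N`-chain (continuity, domination by the window's site sum, blindness to outside momenta), the bond current as a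
two-site observable (`|j_i| ≤ (2 + 8β)(1 + q_i² + p_i² + q_{i+1}² + p_{i+1}²)⁴`), and the assembly of the bonds
touching a bulk window `[a+1, a+2R+1]` into ONE `(2R+3)`-site observable `F = (Σ_c j_c) · g` read at the anchor `a`
(`window_sum_eq`).

All statements proved; `[folklore]`. No definitions, no named facts.
-/

noncomputable section

open MeasureTheory Set Function Finset Filter Topology
open scoped BigOperators

namespace Summit.AtomisticToContinuum.FouriersLaw.Theorems.OddChargeExists.OverlapDensityLimit

open Literature.MathematicalPhysics.KineticTheory.HeatConduction OscillatorChain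
open Summit.AtomisticToContinuum.FouriersLaw.Theorems.LightConeBondHeat
open Summit.AtomisticToContinuum.FouriersLaw.Theorems.NoOddCharge
open Summit.AtomisticToContinuum.FouriersLaw.Theorems.SubBallisticWindow.StaticCurrentBound (bondCurrent_eq_of_succ)

/-! ### §1 Polynomial window densities read on the finite chain -/

section Window

variable {k : ℕ} {g : (Fin k → ℝ × ℝ) → ℝ}

/-- A polynomial window density is continuous. [folklore] -/
theorem continuous_of_poly
    (hg : ∃ p : MvPolynomial (Fin k ⊕ Fin k) ℝ, ∀ y : Fin k → ℝ × ℝ,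
      g y = MvPolynomial.eval (Sum.elim (fun i => (y i).1) (fun i => (y i).2)) p) :
    Continuous g := by
  obtain ⟨p, hp⟩ := hg
  rw [show g = fun y => MvPolynomial.eval (Sum.elim (fun i => (y i).1) (fun i => (y i).2)) p from funext hp]
  refine (MvPolynomial.continuous_eval p).comp (continuous_pi fun s => ?_)
  rcases s with i | i
  · simp only [Sum.elim_inl]; fun_prop
  · simp only [Sum.elim_inr]; fun_prop

/-- A polynomial window density grows polynomially: `|g y| ≤ C B^d` when all coordinates of `y` are
bounded by `B ≥ 1`. [folklore] -/
theorem growth_of_poly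
    (hg : ∃ p : MvPolynomial (Fin k ⊕ Fin k) ℝ, ∀ y : Fin k → ℝ × ℝ,
      g y = MvPolynomial.eval (Sum.elim (fun i => (y i).1) (fun i => (y i).2)) p) :
    ∃ C : ℝ, 0 ≤ C ∧ ∃ d : ℕ, ∀ (y : Fin k → ℝ × ℝ) (B : ℝ), 1 ≤ B →
      (∀ i, |(y i).1| ≤ B) → (∀ i, |(y i).2| ≤ B) → |g y| ≤ C * B ^ d := by
  obtain ⟨p, hp⟩ := hg
  obtain ⟨C, hC, d, h⟩ := exists_abs_eval_le p
  refine ⟨C, hC, d, fun y B hB h1 h2 => ?_⟩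
  rw [hp]
  exact h _ B hB fun s => by rcases s with i | i <;> simp [h1, h2]

/-- The window density read at the sites `x, …, x+k-1` of the `N`-chain is continuous. [folklore] -/
theorem continuous_windowObs {N : ℕ} (x : ℕ) (hgc : Continuous g) :
    Continuous fun z : PhaseSpace N =>
      g (fun i : Fin k => if h : x + i.val < N then (z.1 ⟨x + i.val, h⟩, z.2 ⟨x + i.val, h⟩) else (0, 0)) := by
  refine hgc.comp (continuous_pi fun i => ?_)
  by_cases h : x + i.val < N
  · simp only [dif_pos h]; fun_prop
  · simp only [dif_neg h]; exact continuous_const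

/-- The window density read on the chain is dominated by the site sum of its window. [folklore] -/
theorem abs_windowObs_le {N : ℕ} (x : ℕ) (hx : x + k ≤ N) {C : ℝ} {d : ℕ}
    (hgb : ∀ (y : Fin k → ℝ × ℝ) (B : ℝ), 1 ≤ B →
      (∀ i, |(y i).1| ≤ B) → (∀ i, |(y i).2| ≤ B) → |g y| ≤ C * B ^ d)
    (z : PhaseSpace N) :
    |g (fun i : Fin k => if h : x + i.val < N then (z.1 ⟨x + i.val, h⟩, z.2 ⟨x + i.val, h⟩) else (0, 0))| ≤
      C * (1 + ∑ t : Fin k, (z.1 ⟨x + t.val, by omega⟩ ^ 2 + z.2 ⟨x + t.val, by omega⟩ ^ 2)) ^ d := by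
  set s : Fin k → Fin N := fun t => ⟨x + t.val, by omega⟩ with hs
  have h1 := one_le_siteSum s z
  refine hgb _ _ h1 (fun i => ?_) (fun i => ?_)
  · have hi : x + i.val < N := by omega
    simp only [dif_pos hi]
    exact abs_fst_le_siteSum s z i
  · have hi : x + i.val < N := by omega
    simp only [dif_pos hi]
    exact abs_snd_le_siteSum s z i

/-- The window density read on the chain does not see the momenta outside its window. [folklore] -/
theorem windowObs_update_snd {N : ℕ} (x : ℕ) (z : PhaseSpace N) (l : Fin N) (hl : l.val < x ∨ x + k ≤ l.val)
    (t : ℝ) :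
    g (fun i : Fin k => if h : x + i.val < N then
        (((z.1, Function.update z.2 l t) : PhaseSpace N).1 ⟨x + i.val, h⟩,
          ((z.1, Function.update z.2 l t) : PhaseSpace N).2 ⟨x + i.val, h⟩) else (0, 0)) =
      g (fun i : Fin k => if h : x + i.val < N then (z.1 ⟨x + i.val, h⟩, z.2 ⟨x + i.val, h⟩) else (0, 0)) := by
  congr 1
  funext i
  by_cases h : x + i.val < N
  · simp only [dif_pos h]
    have hne : (⟨x + i.val, h⟩ : Fin N) ≠ l := by
      intro e
      have := congrArg Fin.val e
      simp only at this
      omega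
    rw [Function.update_of_ne hne]
  · simp only [dif_neg h]

end Window

/-! ### §2 The bond current as a two-site observable -/

section Pinned

variable {ω₂ lam β : ℝ}

/-- No bond to the right of the last site: `j_i = 0` if `i + 1 ≥ N`. [folklore] -/
theorem bondCurrent_eq_zero_of_le (P : OscillatorChain) {N : ℕ} {i : Fin N} (h : N ≤ i.val + 1)
    (z : PhaseSpace N) : P.bondCurrent N i z = 0 := by
  unfold OscillatorChain.bondCurrent
  refine Finset.sum_eq_zero fun j _ => ?_
  rw [if_neg]
  intro hv
  have := j.isLt
  omega

/-- **The bond current is dominated by its two-site sum**: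
`|j_i| ≤ (2 + 8β) (1 + q_i² + p_i² + q_{i+1}² + p_{i+1}²)⁴`. [folklore] -/
theorem pinnedChain_abs_bondCurrent_le_siteSum (hβ : 0 ≤ β) (ω₂ lam γ : ℝ) {N : ℕ} (i : Fin N)
    (h : i.val + 1 < N) (z : PhaseSpace N) :
    |(pinnedChain ω₂ lam β γ).bondCurrent N i z| ≤
      (2 + 8 * β) * (1 + ∑ t : Fin 2, (z.1 (![i, ⟨i.val + 1, h⟩] t) ^ 2 + z.2 (![i, ⟨i.val + 1, h⟩] t) ^ 2)) ^ 4 := by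
  set s : Fin 2 → Fin N := ![i, ⟨i.val + 1, h⟩] with hs
  set B := 1 + ∑ t : Fin 2, (z.1 (s t) ^ 2 + z.2 (s t) ^ 2) with hB
  have hB1 : 1 ≤ B := one_le_siteSum s z
  have hq0 : |z.1 i| ≤ B := abs_fst_le_siteSum s z 0
  have hq1 : |z.1 ⟨i.val + 1, h⟩| ≤ B := abs_fst_le_siteSum s z 1
  have hp0 : |z.2 i| ≤ B := abs_snd_le_siteSum s z 0
  have hp1 : |z.2 ⟨i.val + 1, h⟩| ≤ B := abs_snd_le_siteSum s z 1
  rw [bondCurrent_eq_of_lt _ h, pinnedChain_deriv_V, abs_neg, abs_mul]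
  set r := z.1 ⟨i.val + 1, h⟩ - z.1 i with hr
  have hr2 : |r| ≤ 2 * B := by
    calc |r| ≤ |z.1 ⟨i.val + 1, h⟩| + |z.1 i| := abs_sub _ _
      _ ≤ B + B := add_le_add hq1 hq0
      _ = 2 * B := by ring
  have hpa : |(z.2 i + z.2 ⟨i.val + 1, h⟩) / 2| ≤ B := by
    rw [abs_div, abs_two]
    have := abs_add_le (z.2 i) (z.2 ⟨i.val + 1, h⟩)
    linarith
  have hV : |r + β * r ^ 3| ≤ (2 + 8 * β) * B ^ 3 := by
    have h3 : |r| ^ 3 ≤ (2 * B) ^ 3 := pow_le_pow_left₀ (abs_nonneg _) hr2 3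
    have hB3 : B ≤ B ^ 3 := le_self_pow₀ hB1 (by norm_num)
    calc |r + β * r ^ 3| ≤ |r| + |β * r ^ 3| := abs_add_le _ _
      _ = |r| + β * |r| ^ 3 := by rw [abs_mul, abs_of_nonneg hβ, abs_pow]
      _ ≤ 2 * B + β * (2 * B) ^ 3 := add_le_add hr2 (mul_le_mul_of_nonneg_left h3 hβ)
      _ = 2 * B + 8 * β * B ^ 3 := by ring
      _ ≤ 2 * B ^ 3 + 8 * β * B ^ 3 := by nlinarith
      _ = (2 + 8 * β) * B ^ 3 := by ring
  calc |(z.2 i + z.2 ⟨i.val + 1, h⟩) / 2| * |r + β * r ^ 3| ≤ B * ((2 + 8 * β) * B ^ 3) :=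
        mul_le_mul hpa hV (abs_nonneg _) (by linarith)
    _ = (2 + 8 * β) * B ^ 4 := by ring

end Pinned

/-! ### §3 Bookkeeping: the window observable `F = (Σ_c j_c) · g` on `2R+3` sites -/

/-- A two-site sum is dominated by the full site sum. [folklore] -/
theorem pair_siteSum_le {n : ℕ} (w : PhaseSpace n) {i l : Fin n} (h : i ≠ l) :
    1 + ∑ t : Fin 2, (w.1 (![i, l] t) ^ 2 + w.2 (![i, l] t) ^ 2) ≤ 1 + ∑ j : Fin n, (w.1 j ^ 2 + w.2 j ^ 2) := by
  rw [Fin.sum_univ_two]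
  simp only [Matrix.cons_val_zero, Matrix.cons_val_one, Matrix.cons_val_fin_one]
  have h2 : (w.1 i ^ 2 + w.2 i ^ 2) + (w.1 l ^ 2 + w.2 l ^ 2) =
      ∑ j ∈ ({i, l} : Finset (Fin n)), (w.1 j ^ 2 + w.2 j ^ 2) :=
    (Finset.sum_pair (f := fun j => w.1 j ^ 2 + w.2 j ^ 2) h).symm
  have h3 : ∑ j ∈ ({i, l} : Finset (Fin n)), (w.1 j ^ 2 + w.2 j ^ 2) ≤ ∑ j, (w.1 j ^ 2 + w.2 j ^ 2) :=
    Finset.sum_le_sum_of_subset_of_nonneg (Finset.subset_univ _) fun j _ _ => by positivity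
  linarith

/-- **The touching bonds of a bulk window.** For a window `[a+1, a+1+2R]` with `a + 2R + 2 < N`, the sum
over ALL bonds `i` of `∫ j_i g_{a+1} dμ` reduces (far bonds contributing zero) to the expectation of the
single `(2R+3)`-site observable `F = (Σ_{c ≤ 2R+1} j_c) · g(sites 1..2R+1)` read at the anchor `a`. [folklore] -/
theorem window_sum_eq {N R : ℕ} (P : OscillatorChain) (μ : Measure (PhaseSpace N))
    (g : (Fin (2 * R + 1) → ℝ × ℝ) → ℝ) (a : ℕ) (ha : a + (2 * R + 2) < N)
    (hint : ∀ i : Fin N, Integrable (fun z : PhaseSpace N => P.bondCurrent N i z *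
      g (fun t : Fin (2 * R + 1) => if h : a + 1 + t.val < N then (z.1 ⟨a + 1 + t.val, h⟩, z.2 ⟨a + 1 + t.val, h⟩)
        else (0, 0))) μ)
    (hfar : ∀ i : Fin N, (i.val + 1 < a + 1 ∨ a + 1 + 2 * R < i.val) →
      ∫ z, P.bondCurrent N i z *
        g (fun t : Fin (2 * R + 1) => if h : a + 1 + t.val < N then (z.1 ⟨a + 1 + t.val, h⟩, z.2 ⟨a + 1 + t.val, h⟩)
          else (0, 0)) ∂μ = 0) :
    ∑ i : Fin N, ∫ z, P.bondCurrent N i z *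
        g (fun t : Fin (2 * R + 1) => if h : a + 1 + t.val < N then (z.1 ⟨a + 1 + t.val, h⟩, z.2 ⟨a + 1 + t.val, h⟩)
          else (0, 0)) ∂μ =
      ∫ z, (∑ c : Fin (2 * R + 2), P.bondCurrent (2 * R + 2 + 1) ⟨c.val, by omega⟩
          ((fun j : Fin (2 * R + 2 + 1) => z.1 ⟨a + j.val, by omega⟩),
            fun j : Fin (2 * R + 2 + 1) => z.2 ⟨a + j.val, by omega⟩)) *
        g (fun t : Fin (2 * R + 1) => (z.1 ⟨a + (t.val + 1), by omega⟩, z.2 ⟨a + (t.val + 1), by omega⟩)) ∂μ := by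
  classical
  -- restrict the bond sum to the touching bonds `a, …, a + 2R + 1`
  have hS : ∑ i ∈ (Finset.univ : Finset (Fin (2 * R + 2))).image (fun c => (⟨a + c.val, by omega⟩ : Fin N)),
      ∫ z, P.bondCurrent N i z *
        g (fun t : Fin (2 * R + 1) => if h : a + 1 + t.val < N then (z.1 ⟨a + 1 + t.val, h⟩, z.2 ⟨a + 1 + t.val, h⟩)
          else (0, 0)) ∂μ =
      ∑ i : Fin N, ∫ z, P.bondCurrent N i z *
        g (fun t : Fin (2 * R + 1) => if h : a + 1 + t.val < N then (z.1 ⟨a + 1 + t.val, h⟩, z.2 ⟨a + 1 + t.val, h⟩)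
          else (0, 0)) ∂μ := by
    apply Finset.sum_subset (Finset.subset_univ _)
    intro i _ hi
    apply hfar i
    by_contra hcon
    apply hi
    rw [Finset.mem_image]
    refine ⟨⟨i.val - a, by omega⟩, Finset.mem_univ _, Fin.ext ?_⟩
    simp only
    omega
  rw [← hS, Finset.sum_image (fun c _ c' _ h => by
    have h' := congrArg Fin.val h
    exact Fin.ext (by simp only at h'; omega))]
  rw [← integral_finsetSum _ (fun c _ => hint _)]
  refine integral_congr_ae (Eventually.of_forall fun z => ?_)
  beta_reduce
  rw [Finset.sum_mul]
  refine Finset.sum_congr rfl fun c _ => ?_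
  have hg' : g (fun t : Fin (2 * R + 1) => if h : a + 1 + t.val < N then (z.1 ⟨a + 1 + t.val, h⟩, z.2 ⟨a + 1 + t.val, h⟩)
        else (0, 0)) =
      g (fun t : Fin (2 * R + 1) => (z.1 ⟨a + (t.val + 1), by omega⟩, z.2 ⟨a + (t.val + 1), by omega⟩)) := by
    congr 1
    funext t
    rw [dif_pos (by omega)]
    have e : (⟨a + 1 + t.val, by omega⟩ : Fin N) = ⟨a + (t.val + 1), by omega⟩ := Fin.ext (by simp only; omega)
    rw [e]
  rw [hg', bondCurrent_eq_of_succ P (i := ⟨a + c.val, by omega⟩) (j := ⟨a + (c.val + 1), by omega⟩) (by simp only; omega),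
    bondCurrent_eq_of_succ P (i := (⟨c.val, by omega⟩ : Fin (2 * R + 2 + 1))) (j := ⟨c.val + 1, by omega⟩)
      (by simp only)]

/-- **Registered sub-goal `stub_overlapDensityLimit_windowSum`** (part 2 of `stub_overlapDensityLimit`): the bonds
touching a bulk window assemble to the single `(2R+3)`-site observable `F = (Σ_c j_c) · g` — the closed form of
`window_sum_eq`. -/
theorem stub_overlapDensityLimit_windowSum : ∀ (N R : ℕ) (P : Literature.MathematicalPhysics.KineticTheory.HeatConduction.OscillatorChain) (μ : MeasureTheory.Measure (Literature.MathematicalPhysics.KineticTheory.HeatConduction.PhaseSpace N)) (g : (Fin (2 * R + 1) → ℝ × ℝ) → ℝ) (a : ℕ) (ha : a + (2 * R + 2) < N), (∀ i : Fin N, MeasureTheory.Integrable (fun z : Literature.MathematicalPhysics.KineticTheory.HeatConduction.PhaseSpace N => P.bondCurrent N i z * g (fun t : Fin (2 * R + 1) => if h : a + 1 + t.val < N then (z.1 ⟨a + 1 + t.val, h⟩, z.2 ⟨a + 1 + t.val, h⟩) else (0, 0))) μ) → (∀ i : Fin N, (i.val + 1 < a + 1 ∨ a + 1 + 2 * R <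 i.val) → ∫ z, P.bondCurrent N i z * g (fun t : Fin (2 * R + 1) => if h : a + 1 + t.val < N then (z.1 ⟨a + 1 + t.val, h⟩, z.2 ⟨a + 1 + t.val, h⟩) else (0, 0)) ∂μ = 0) → ∑ i : Fin N, ∫ z, P.bondCurrent N i z * g (fun t : Fin (2 * R + 1) => if h : a + 1 + t.val < N then (z.1 ⟨a + 1 + t.val, h⟩, z.2 ⟨a + 1 + t.val, h⟩) else (0, 0)) ∂μ = ∫ z, (∑ c : Fin (2 * R + 2), P.bondCurrent (2 * R + 2 + 1) ⟨c.val, by omega⟩ ((fun j : Fin (2 * R + 2 + 1) => z.1 ⟨a + j.val, by omega⟩), fun j : Fin (2 * R + 2 + 1) => z.2 ⟨a + j.val, by omega⟩)) * g (fun t : Fin (2 * R + 1) => (z.1 ⟨a + (t.val + 1), by omega⟩, z.2 ⟨a + (t.val + 1), by omega⟩)) ∂μ :=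
  fun _ _ P μ g a ha hint hfar => window_sum_eq P μ g a ha hint hfar

end Summit.AtomisticToContinuum.FouriersLaw.Theorems.OddChargeExists.OverlapDensityLimit

end
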